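import Literature.NumberTheory.EllipticCurves.PastenValuationProduct
import Literature.NumberTheory.EllipticCurves.SzpiroOfAbcProofs
import Literature.NumberTheory.DiophantineGeometry.ConductorExponentLeEightProofs
import Literature.NumberTheory.DiophantineGeometry.AbcWave0
import HarnessLib

/-!
# Pasten's Lemma 6.10 from Darmon–Granville's Theorem 2

Topic `NumberTheory/EllipticCurves`; namespace `Literature.NumberTheory.EllipticCurves` (with the
grouping sub-namespace `PastenLemma610` for the lemmas of the proof). Proofs sibling of
`Literature/NumberTheory/EllipticCurves/PastenValuationProduct.lean` for its named fact
`PastenShimura2024_lemma_6_10` (H. Pasten, *Shimura curves and the abc conjecture*, J. Number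
Theory 254 (2024) 214–335 = arXiv:1705.09251, §6.5, Lemma 6.10, held text p. 22). Theorems only:
NO definition and NO new named fact (D-0026).

## The printed statement and proof (arXiv:1705.09251, p. 22)

"**Lemma 6.10.** Let `L ≥ 7` be an integer and let `S` be a finite set of primes. There is a
number `N₀ = N₀(L,S)` depending only on `L` and `S` such that there is no elliptic curve `E` over
`ℚ` with conductor `N_E ≥ N₀`, semi-stable reduction away from `S`, and with minimal discriminant
of the form `Δ_E = n·k^L` with `n` and `k` integers such that all the prime factors of `n` are in
`S`." Printed proof: for `E` semi-stable away from `S` the invariants `c₄, c₆` of a minimal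
equation share only primes of `S' = S ∪ {2, 3}` (Silverman AEC Ex. 8.21); `±1728 Δ_E = c₄³ − c₆²`,
so `Δ_E = n k^L` with `n` an `S`-unit gives an integer solution of `A·x^L = y³ − z²` with `A` an
`S'`-unit (w.l.o.g. with exponents `< L`, finitely many `A`) and `gcd(y, z)` an `S'`-unit; "Since
`1/2 + 1/3 + 1/L < 1`, Lemma 6.9 gives that each one of these finitely many equations has only
finitely many solutions, and we obtain only a finite list of possible quantities `c₄` and `c₆`",
whence finitely many `E`, bounded conductor. Lemma 6.9 (p. 22) is Darmon–Granville's Theorem 2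
[DarmonGranville1995, Thm 2, p. 515] "replacing the set of places `V_{ABC}` by `V_{ABC} ∪ S`"
(proof: one sentence): finiteness of the integer solutions of `A x^p + B y^q = C z^r`
(`1/p + 1/q + 1/r < 1`) whose common prime factors lie in `S`.

## What is proved here, and how it follows the text

* `PastenShimura2024_lemma_6_10_of_darmonGranville1995_thm_2` — **Lemma 6.10 (as vendored: the
  conductor bound) follows from Darmon–Granville's Theorem 2 as printed** (proper solutions,
  general non-zero coefficients: the tree's named fact
  `Literature.NumberTheory.DiophantineGeometry.darmonGranville1995_thm_2`, not yet discharged —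
  its printed proof needs Faltings' theorem and the Riemann existence theorem, see its docstring).
  So `PastenShimura2024_lemma_6_10_holds` is ONE line away from that fact and from nothing else.
* `finite_minimalDiscriminantNorm_of_darmonGranville1995_thm_2` — the same for **Lemma 6.10 in
  the form its printed proof ends with** ("for fixed `S` and `L`, there are only finitely many
  elliptic curves `E` over `ℚ` with `Δ_E = n·k^L` …", recorded as finiteness of the set of the
  `|Δ_E|`), verbatim the hypothesis `h610` of
  `Literature.NumberTheory.Automorphic.PastenShimura2024_thm_6_17'` and of its corollaries.
* `PastenLemma610.conductor_bounded_of_finite_properSolutions`,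
  `PastenLemma610.finite_minimalDiscriminantNorm_of_finite_properSolutions` — both statements at
  ONE exponent `L ≥ 3`, from the finiteness of the proper solutions of `A x^L + B y² = C z³` for
  all non-zero `A, B, C` (Theorem 2 at the single signature `(L, 2, 3)`), which is all the printed
  proof uses; the two theorems above are their specialisations to `darmonGranville1995_thm_2`, and
  `PastenValuationProductLemma610OfFaltings` feeds them the per-signature Darmon–Granville theorem
  (ONE `(2, 3, r)` covering with `r ∣ L` and Faltings' theorem).

The assembly is the printed one, in the tree's vocabulary (`W : WeierstrassCurve ℚ`,
`N_E = W.conductorNorm ℤ`, `|Δ_E| = W.minimalDiscriminantNorm ℤ`):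

1. (AEC VIII.8.3) pass to a global minimal equation `W₀` over `ℤ`
   (`WeierstrassCurve.exists_baseChange_int_forall_isMinimalAt`): `N_E` and `|Δ_E|` are
   isomorphism invariants (`conductorNorm_smul_rat`, `minimalDiscriminantNorm_smul_rat`) and
   `|Δ_E| = |Δ(W₀)|` (`minimalDiscriminantNorm_eq_natAbs_holds`);
2. (AEC Ex. 8.21, the first sentence of the printed proof) a prime `p ∉ S ∪ {2,3}` dividing
   `c₄(W₀)` and `k` divides `Δ(W₀)`, hence is a prime of additive reduction and `p² ∣ N_E`
   (`sq_dvd_conductorNorm_of_dvd_Δ_of_dvd_c₄`), excluded by semi-stability away from `S`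
   (rendered, as in the fact, by `p² ∤ N_E`) — `PastenLemma610.dioph_setup`;
3. `1728 Δ(W₀) = c₄³ − c₆²` (Mathlib `WeierstrassCurve.c_relation`) and `|Δ(W₀)| = n k^L` give the
   solution `(x, y, z) = (k, c₆, c₄)` of `A x^L + y² = z³`, `A = 1728 · sign(Δ) · n` supported on
   `T := (primes of S) ∪ {2, 3}`, whose common prime divisors lie in `T` (step 2);
4. (the reduction to finitely many equations, made explicit; replaces the appeal to Lemma 6.9)
   `PastenLemma610.exists_proper_solution`: dividing the three terms `A x^L, y², z³` by their gcd
   `G` (a `T`-unit) and absorbing quotients into the variables and remainders into the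
   coefficients produces a PROPER solution `(x', y', z')` of an equation `A' X^L + B' Y² = C' Z³`
   with `0 < |A'|, |B'|, |C'| ≤ ∏_{ℓ ∈ T} ℓ^L`, such that every prime `p ∉ T` dividing `x`
   divides `x' ≠ 0`, and `y² = G·B'·y'²`, `z³ = G·C'·z'³`;
5. (Lemma 6.9 ← [DarmonGranville1995, Thm 2], signature `(L, 2, 3)`, hyperbolic iff `L ≥ 7`)
   `PastenLemma610.exists_bounds_of_darmonGranville`: these finitely many equations have
   finitely many proper solutions, so there are `B₀, B₁` depending on `L, T` only with `p ≤ B₀`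
   for every prime `p ∉ T` dividing `x = k`, and `y², |z|³ ≤ G · B₁`;
6. (conductor form) every prime `p ∣ N_E` divides `|Δ_E| = n k^L` (`radical_conductorNorm_eq_holds`),
   so lies in `T` or divides `k`, hence lies in the finite set `F = T ∪ {primes ≤ B₀}`; with
   `f_p ≤ 8` (`conductorExponent_le_eight_holds`, `factorization_conductorNorm_holds`) this gives
   `N_E ≤ ∏_{p ∈ F} p⁸ =: N₀ − 1`;
7. (finiteness form, "a finite list of possible quantities `c₄` and `c₆`") minimality of `W₀` at
   the primes of `T` (AEC Ex. 8.21 again: `p⁸ ∤ c₄` or `p¹¹ ∤ c₆`, the tree's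
   `not_pow_dvd_c₄_c₆_of_isMinimalAt{,_two,_three}`) bounds `G ≤ ∏_{p ∈ T} p²¹`
   (`PastenLemma610.gcd_le_of_isMinimalAt`), so `1728 |Δ_E| ≤ |c₄|³ + c₆² ≤ 2 G B₁` is bounded.

Deviations from the letter of the text, and why. (a) The text concludes "only finitely many
elliptic curves"; what is recorded (by the fact, resp. by `h610`) is the conductor bound, resp.
the finiteness of the minimal discriminants, and steps 6–7 reach these without classifying the
curves. (b) Lemma 6.9 is not used as printed. Read literally it admits, from any one solution, the
infinite family `(ℓ^{qr·t} x, ℓ^{pr·t} y, ℓ^{pq·t} z)`, `ℓ ∈ S`, of solutions with the same common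
primes outside `S` (e.g. `x⁴ + y⁴ = 2 z⁴`, `S = {2}`, `(2^{16t}, 2^{16t}, 2^{16t})`); what the
indicated modification of Darmon–Granville's argument yields is finiteness up to this weighted
`S`-unit scaling (equivalently, of the parameter `t = A x^p / C z^r`), which is all that Lemma 6.10
needs. Step 4 is the elementary normalisation reducing this `S`-coprime finiteness to Theorem 2
itself for finitely many coefficient triples, so the only unproved input is the tree's existing
fact `darmonGranville1995_thm_2`.

## References

* [PastenShimura2024] H. Pasten, *Shimura curves and the abc conjecture*, J. Number Theory 254
  (2024) 214–335, doi:10.1016/j.jnt.2023.07.002, arXiv:1705.09251 — §6.5, Lemmas 6.9 and 6.10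
  (held text, p. 22).
* [DarmonGranville1995] H. Darmon, A. Granville, *On the equations `z^m = F(x, y)` and
  `A x^p + B y^q = C z^r`*, Bull. London Math. Soc. 27 (1995) 513–543 — Theorem 2 (p. 515),
  proof pp. 526–527.
* [SilvermanAEC2009] J. H. Silverman, *The Arithmetic of Elliptic Curves*, 2nd ed. (2009) —
  III.1 (`1728 Δ = c₄³ − c₆²`), VII.1 Remark 1.1, VII.5.1, VIII.8 Cor. 8.3, VIII.11 and
  Exercise 8.21.
-/

namespace Literature.NumberTheory.EllipticCurves

namespace PastenLemma610

open Finset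

/-! ### Products of prime powers over a finite set of primes -/

/-- Cast of a product of prime powers from `ℕ` to `ℤ`. [folklore] -/
theorem natCast_prod_pow (P : Finset ℕ) (f : ℕ → ℕ) :
    ((∏ ℓ ∈ P, ℓ ^ f ℓ : ℕ) : ℤ) = ∏ ℓ ∈ P, (ℓ : ℤ) ^ f ℓ := by
  push_cast; rfl

/-- The absolute value of a product of powers of naturals, computed in `ℤ`. [folklore] -/
theorem natAbs_prod_pow (P : Finset ℕ) (f : ℕ → ℕ) :
    (∏ ℓ ∈ P, (ℓ : ℤ) ^ f ℓ).natAbs = ∏ ℓ ∈ P, ℓ ^ f ℓ := by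
  rw [← natCast_prod_pow, Int.natAbs_natCast]

/-- A product of powers of primes is non-zero. [folklore] -/
theorem prod_pow_ne_zero {P : Finset ℕ} (hP : ∀ ℓ ∈ P, ℓ.Prime) (f : ℕ → ℕ) :
    (∏ ℓ ∈ P, (ℓ : ℤ) ^ f ℓ) ≠ 0 :=
  Finset.prod_ne_zero_iff.mpr fun ℓ hℓ => pow_ne_zero _ (by exact_mod_cast (hP ℓ hℓ).ne_zero)

/-- A non-zero natural number all of whose prime factors lie in the finite set `P` is
`∏_{ℓ ∈ P} ℓ ^ {v_ℓ}`. [folklore] -/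
theorem nat_eq_prod_pow_factorization {P : Finset ℕ} {n : ℕ} (hn : n ≠ 0)
    (h : n.primeFactors ⊆ P) : n = ∏ ℓ ∈ P, ℓ ^ n.factorization ℓ := by
  rw [← Finsupp.prod_of_support_subset n.factorization (s := P)
    (by rwa [Nat.support_factorization]) (fun p k => p ^ k) (fun _ _ => pow_zero _)]
  exact (Nat.prod_factorization_pow_eq_self hn).symm

/-- An integer all of whose prime factors lie in the finite set `P` is its sign times
`∏_{ℓ ∈ P} ℓ ^ {v_ℓ}` (`v_ℓ` the exponent of `ℓ` in `|y|`; also true for `y = 0`, both sides being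
`0`). [folklore] -/
theorem eq_sign_mul_prod_pow_factorization {P : Finset ℕ} (y : ℤ)
    (hy : y.natAbs.primeFactors ⊆ P) :
    y = y.sign * ∏ ℓ ∈ P, (ℓ : ℤ) ^ (y.natAbs.factorization ℓ) := by
  rcases eq_or_ne y 0 with rfl | hy0
  · simp
  conv_lhs => rw [← Int.sign_mul_natAbs y,
    nat_eq_prod_pow_factorization (Int.natAbs_ne_zero.mpr hy0) hy]
  rw [natCast_prod_pow]

/-- A prime `p` divides `∏_{ℓ ∈ P} ℓ ^ {f ℓ}` (`P` a finite set of primes) iff `p ∈ P` and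
`f p ≠ 0`. [folklore] -/
theorem prime_dvd_prod_pow_iff {P : Finset ℕ} (hP : ∀ ℓ ∈ P, ℓ.Prime) {p : ℕ} (hp : p.Prime)
    (f : ℕ → ℕ) : (p : ℤ) ∣ ∏ ℓ ∈ P, (ℓ : ℤ) ^ f ℓ ↔ p ∈ P ∧ f p ≠ 0 := by
  have hpz : Prime (p : ℤ) := Nat.prime_iff_prime_int.mp hp
  rw [hpz.dvd_finsetProd_iff]
  constructor
  · rintro ⟨ℓ, hℓ, hdvd⟩
    have h1 : (p : ℤ) ∣ ℓ := hpz.dvd_of_dvd_pow hdvd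
    have hf : f ℓ ≠ 0 := by
      rintro h0
      rw [h0, pow_zero] at hdvd
      exact hp.not_dvd_one (by exact_mod_cast hdvd)
    obtain rfl : p = ℓ :=
      (Nat.prime_dvd_prime_iff_eq hp (hP ℓ hℓ)).mp (Int.natCast_dvd_natCast.mp h1)
    exact ⟨hℓ, hf⟩
  · rintro ⟨hpP, hf⟩
    exact ⟨p, hpP, dvd_pow_self _ hf⟩

/-- The exponent of `ℓ` in `gcd(u, w)` (`u ≠ 0`) is that of `u`, or that of `w` if `w ≠ 0`
(`v_ℓ(gcd) = min`, and `gcd(u, 0) = |u|`). [folklore] -/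
theorem factorization_gcd_eq_or {u w : ℤ} (hu : u ≠ 0) (ℓ : ℕ) :
    (Int.gcd u w).factorization ℓ = u.natAbs.factorization ℓ ∨
      (w ≠ 0 ∧ (Int.gcd u w).factorization ℓ = w.natAbs.factorization ℓ) := by
  rcases eq_or_ne w 0 with rfl | hw
  · left; rw [Int.gcd_zero_right]
  · rw [Int.gcd_eq_natAbs, Nat.factorization_gcd (Int.natAbs_ne_zero.mpr hu)
      (Int.natAbs_ne_zero.mpr hw), Finsupp.inf_apply]
    rcases le_total (u.natAbs.factorization ℓ) (w.natAbs.factorization ℓ) with h | h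
    · left; exact min_eq_left h
    · right; exact ⟨hw, min_eq_right h⟩

/-- If `d ∣ n ≠ 0` then `v_ℓ(d) ≤ v_ℓ(n)` for every `ℓ`. [folklore] -/
theorem factorization_le_of_natCast_dvd {d : ℕ} {n : ℤ} (hn : n ≠ 0) (h : (d : ℤ) ∣ n) (ℓ : ℕ) :
    d.factorization ℓ ≤ n.natAbs.factorization ℓ := by
  rcases eq_or_ne d 0 with rfl | hd
  · simp
  exact (Nat.factorization_le_iff_dvd hd (Int.natAbs_ne_zero.mpr hn)).mpr (Int.natCast_dvd.mp h) ℓ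

/-- **One term of the normalisation.** For a term `c · w^d` with `c = cs · ∏ ℓ^{α ℓ}`,
`w = s · ∏ ℓ^{a ℓ}` and exponents `e ℓ` with `m ℓ + e ℓ = α ℓ + d · a ℓ` (i.e. `e = α + d a − m`,
division of the term by `∏ ℓ^{m ℓ}`), writing `e = d · q + r` (`q = e / d`, `r = e % d`):
`∏ ℓ^{m} · ((cs ∏ ℓ^{r}) · (s ∏ ℓ^{q})^d) = c · w^d`. The disjunct `s = 0` covers a vanishing
variable `w = 0`. [folklore] -/
theorem term_identity (P : Finset ℕ) (cs s : ℤ) (α a m e : ℕ → ℕ) {d : ℕ} (hd : d ≠ 0)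
    (h : s = 0 ∨ ∀ ℓ ∈ P, m ℓ + e ℓ = α ℓ + d * a ℓ) :
    (∏ ℓ ∈ P, (ℓ : ℤ) ^ m ℓ) *
        ((cs * ∏ ℓ ∈ P, (ℓ : ℤ) ^ (e ℓ % d)) * (s * ∏ ℓ ∈ P, (ℓ : ℤ) ^ (e ℓ / d)) ^ d) =
      (cs * ∏ ℓ ∈ P, (ℓ : ℤ) ^ α ℓ) * (s * ∏ ℓ ∈ P, (ℓ : ℤ) ^ a ℓ) ^ d := by
  rcases h with rfl | h
  · simp [zero_pow hd]
  have key : ∀ ℓ ∈ P, (ℓ : ℤ) ^ m ℓ * ((ℓ : ℤ) ^ (e ℓ % d) * ((ℓ : ℤ) ^ (e ℓ / d)) ^ d) =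
      (ℓ : ℤ) ^ α ℓ * ((ℓ : ℤ) ^ a ℓ) ^ d := by
    intro ℓ hℓ
    rw [← pow_mul, ← pow_add, ← pow_add, ← pow_mul, ← pow_add]
    congr 1
    have h1 := Nat.mod_add_div (e ℓ) d
    have h2 := h ℓ hℓ
    calc m ℓ + (e ℓ % d + e ℓ / d * d) = m ℓ + (e ℓ % d + d * (e ℓ / d)) := by rw [mul_comm _ d]
      _ = m ℓ + e ℓ := by rw [h1]
      _ = α ℓ + d * a ℓ := h2
      _ = α ℓ + a ℓ * d := by rw [mul_comm d]
  have hprod : (∏ ℓ ∈ P, (ℓ : ℤ) ^ m ℓ) * ((∏ ℓ ∈ P, (ℓ : ℤ) ^ (e ℓ % d)) *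
      (∏ ℓ ∈ P, (ℓ : ℤ) ^ (e ℓ / d)) ^ d) =
      (∏ ℓ ∈ P, (ℓ : ℤ) ^ α ℓ) * (∏ ℓ ∈ P, (ℓ : ℤ) ^ a ℓ) ^ d := by
    rw [← Finset.prod_pow, ← Finset.prod_pow, ← Finset.prod_mul_distrib, ← Finset.prod_mul_distrib,
      ← Finset.prod_mul_distrib]
    exact Finset.prod_congr rfl key
  calc (∏ ℓ ∈ P, (ℓ : ℤ) ^ m ℓ) *
        ((cs * ∏ ℓ ∈ P, (ℓ : ℤ) ^ (e ℓ % d)) * (s * ∏ ℓ ∈ P, (ℓ : ℤ) ^ (e ℓ / d)) ^ d)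
        = cs * s ^ d * ((∏ ℓ ∈ P, (ℓ : ℤ) ^ m ℓ) * ((∏ ℓ ∈ P, (ℓ : ℤ) ^ (e ℓ % d)) *
            (∏ ℓ ∈ P, (ℓ : ℤ) ^ (e ℓ / d)) ^ d)) := by ring
    _ = cs * s ^ d * ((∏ ℓ ∈ P, (ℓ : ℤ) ^ α ℓ) * (∏ ℓ ∈ P, (ℓ : ℤ) ^ a ℓ) ^ d) := by rw [hprod]
    _ = (cs * ∏ ℓ ∈ P, (ℓ : ℤ) ^ α ℓ) * (s * ∏ ℓ ∈ P, (ℓ : ℤ) ^ a ℓ) ^ d := by ring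

/-- Bound for the normalised coefficients: if the exponents vanish off `T ⊆ P` and are `≤ L` on
`T`, then `∏_{ℓ ∈ P} ℓ^{f ℓ} ≤ ∏_{ℓ ∈ T} ℓ^L`. [folklore] -/
theorem prod_pow_le_prod_pow {P T : Finset ℕ} (hTP : T ⊆ P) (hT : ∀ ℓ ∈ T, ℓ.Prime)
    {f : ℕ → ℕ} {L : ℕ} (h0 : ∀ ℓ ∈ P, ℓ ∉ T → f ℓ = 0) (hle : ∀ ℓ ∈ T, f ℓ ≤ L) :
    ∏ ℓ ∈ P, ℓ ^ f ℓ ≤ ∏ ℓ ∈ T, ℓ ^ L := by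
  rw [← Finset.prod_sdiff hTP, Finset.prod_eq_one (fun ℓ hℓ => ?_), one_mul]
  · exact Finset.prod_le_prod (fun _ _ => Nat.zero_le _)
      fun ℓ hℓ => Nat.pow_le_pow_right (hT ℓ hℓ).pos (hle ℓ hℓ)
  · rw [Finset.mem_sdiff] at hℓ
    rw [h0 ℓ hℓ.1 hℓ.2, pow_zero]

/-! ### The normalisation: from `T`-coprime solutions to proper solutions -/

/-- The primes of `G = gcd(A x^L, y², z³)` lie in `T` when `A` is supported on `T` and the common
prime divisors of `x, y, z` lie in `T`. [folklore] -/
theorem mem_of_prime_dvd_gcd {T : Finset ℕ} {L : ℕ} {A x y z : ℤ}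
    (hAT : ∀ p : ℕ, p.Prime → (p : ℤ) ∣ A → p ∈ T)
    (hcop : ∀ p : ℕ, p.Prime → (p : ℤ) ∣ x → (p : ℤ) ∣ y → (p : ℤ) ∣ z → p ∈ T)
    {p : ℕ} (hp : p.Prime) (hpG : p ∣ Int.gcd (Int.gcd (A * x ^ L) (y ^ 2)) (z ^ 3)) : p ∈ T := by
  have hpz : Prime (p : ℤ) := Nat.prime_iff_prime_int.mp hp
  have h1 : (p : ℤ) ∣ (Int.gcd (Int.gcd (A * x ^ L) (y ^ 2)) (z ^ 3) : ℤ) :=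
    Int.natCast_dvd_natCast.mpr hpG
  have hy' : (p : ℤ) ∣ y :=
    hpz.dvd_of_dvd_pow (h1.trans ((Int.gcd_dvd_left _ _).trans (Int.gcd_dvd_right _ _)))
  have hz' : (p : ℤ) ∣ z := hpz.dvd_of_dvd_pow (h1.trans (Int.gcd_dvd_right _ _))
  rcases hpz.dvd_or_dvd (h1.trans ((Int.gcd_dvd_left _ _).trans (Int.gcd_dvd_left _ _))) with
    hA' | hx'
  · exact hAT p hp hA'
  · exact hcop p hp (hpz.dvd_of_dvd_pow hx') hy' hz'

/-- **Normalisation of a `T`-coprime solution of `A x^L + y² = z³` to a proper solution of one of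
finitely many equations** (the reduction behind "one only needs to consider finitely many
equations of this sort" and behind Lemma 6.9's "replacing `V_{ABC}` by `V_{ABC} ∪ S`",
[PastenShimura2024, p. 22], made explicit). Let `T` be a finite set of primes, `L ≥ 3`,
`A ≠ 0` supported on `T`, `x ≠ 0`, and `A x^L + y² = z³` with every common prime divisor of
`x, y, z` in `T`. Let `G = gcd(A x^L, y², z³)`, `m_ℓ = v_ℓ(G)`, and at each prime `ℓ` write
`v_ℓ(A) + L v_ℓ(x) − m_ℓ = L q₁ + r₁`, `2 v_ℓ(y) − m_ℓ = 2 q₂ + r₂`, `3 v_ℓ(z) − m_ℓ = 3 q₃ + r₃`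
(`0 ≤ r₁ < L`, `r₂ < 2`, `r₃ < 3`). Then `A' = ±∏ ℓ^{r₁}`, `B' = ∏ ℓ^{r₂}`, `C' = ∏ ℓ^{r₃}` and
`x' = ±∏ ℓ^{q₁}`, `y' = ±∏ ℓ^{q₂}`, `z' = ±∏ ℓ^{q₃}` satisfy: `A' x'^L + B' y'² = C' z'³` (the
original equation divided by `G`); `gcd(x', y', z') = 1` (at each `ℓ` the minimum `m_ℓ` is attained
by a non-zero term, whose new variable is an `ℓ`-unit); `|A'|, |B'|, |C'| ≤ ∏_{ℓ ∈ T} ℓ^L` (off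
`T` one has `v_ℓ(A) = m_ℓ = 0`, so `r₁ = r₂ = r₃ = 0`); `x' ≠ 0`; a prime `p ∉ T` divides `x'`
as soon as it divides `x` (`q₁ = v_p(x)` there); and `y² = G B' y'²`, `z³ = G C' z'³`.
[folklore] -/
theorem exists_proper_solution {T : Finset ℕ} (hT : ∀ ℓ ∈ T, ℓ.Prime) {L : ℕ} (hL : 3 ≤ L)
    {A x y z : ℤ} (hA : A ≠ 0) (hx : x ≠ 0)
    (hAT : ∀ p : ℕ, p.Prime → (p : ℤ) ∣ A → p ∈ T)
    (hcop : ∀ p : ℕ, p.Prime → (p : ℤ) ∣ x → (p : ℤ) ∣ y → (p : ℤ) ∣ z → p ∈ T)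
    (heq : A * x ^ L + y ^ 2 = z ^ 3) :
    ∃ A' B' C' x' y' z' : ℤ, A' ≠ 0 ∧ B' ≠ 0 ∧ C' ≠ 0 ∧
      A'.natAbs ≤ ∏ ℓ ∈ T, ℓ ^ L ∧ B'.natAbs ≤ ∏ ℓ ∈ T, ℓ ^ L ∧ C'.natAbs ≤ ∏ ℓ ∈ T, ℓ ^ L ∧
      (∀ p : ℕ, p.Prime → ¬ ((p : ℤ) ∣ x' ∧ (p : ℤ) ∣ y' ∧ (p : ℤ) ∣ z')) ∧
      A' * x' ^ L + B' * y' ^ 2 = C' * z' ^ 3 ∧ x' ≠ 0 ∧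
      (∀ p : ℕ, p.Prime → p ∉ T → (p : ℤ) ∣ x → (p : ℤ) ∣ x') ∧
      (Int.gcd (Int.gcd (A * x ^ L) (y ^ 2)) (z ^ 3) : ℤ) * (B' * y' ^ 2) = y ^ 2 ∧
      (Int.gcd (Int.gcd (A * x ^ L) (y ^ 2)) (z ^ 3) : ℤ) * (C' * z' ^ 3) = z ^ 3 := by
  classical
  have hL0 : L ≠ 0 := by omega
  have hLpos : 0 < L := by omega
  have hAxL : A * x ^ L ≠ 0 := mul_ne_zero hA (pow_ne_zero _ hx)
  -- the gcd `G` of the three terms `A x^L`, `y²`, `z³`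
  have hG₁ : Int.gcd (A * x ^ L) (y ^ 2) ≠ 0 := fun h => hAxL (Int.gcd_eq_zero_iff.mp h).1
  have hG₁z : ((Int.gcd (A * x ^ L) (y ^ 2) : ℕ) : ℤ) ≠ 0 := by exact_mod_cast hG₁
  set G : ℕ := Int.gcd (Int.gcd (A * x ^ L) (y ^ 2)) (z ^ 3) with hG
  have hG0 : G ≠ 0 := fun h => hG₁z (Int.gcd_eq_zero_iff.mp h).1
  have hGd₁ : (G : ℤ) ∣ A * x ^ L := (Int.gcd_dvd_left _ _).trans (Int.gcd_dvd_left _ _)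
  have hGd₂ : (G : ℤ) ∣ y ^ 2 := (Int.gcd_dvd_left _ _).trans (Int.gcd_dvd_right _ _)
  have hGd₃ : (G : ℤ) ∣ z ^ 3 := Int.gcd_dvd_right _ _
  -- valuations of the three terms
  have hvAx : ∀ ℓ, (A * x ^ L).natAbs.factorization ℓ =
      A.natAbs.factorization ℓ + L * x.natAbs.factorization ℓ := by
    intro ℓ
    rw [Int.natAbs_mul, Int.natAbs_pow, Nat.factorization_mul (Int.natAbs_ne_zero.mpr hA)
      (pow_ne_zero _ (Int.natAbs_ne_zero.mpr hx)), Finsupp.add_apply, Nat.factorization_pow,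
      Finsupp.smul_apply, smul_eq_mul]
  have hvy2 : ∀ ℓ, (y ^ 2).natAbs.factorization ℓ = 2 * y.natAbs.factorization ℓ := by
    intro ℓ; rw [Int.natAbs_pow, Nat.factorization_pow, Finsupp.smul_apply, smul_eq_mul]
  have hvz3 : ∀ ℓ, (z ^ 3).natAbs.factorization ℓ = 3 * z.natAbs.factorization ℓ := by
    intro ℓ; rw [Int.natAbs_pow, Nat.factorization_pow, Finsupp.smul_apply, smul_eq_mul]
  have hm₁ : ∀ ℓ, G.factorization ℓ ≤ A.natAbs.factorization ℓ + L * x.natAbs.factorization ℓ :=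
    fun ℓ => (hvAx ℓ) ▸ factorization_le_of_natCast_dvd hAxL hGd₁ ℓ
  have hm₂ : ∀ ℓ, y ≠ 0 → G.factorization ℓ ≤ 2 * y.natAbs.factorization ℓ :=
    fun ℓ hy => (hvy2 ℓ) ▸ factorization_le_of_natCast_dvd (pow_ne_zero _ hy) hGd₂ ℓ
  have hm₃ : ∀ ℓ, z ≠ 0 → G.factorization ℓ ≤ 3 * z.natAbs.factorization ℓ :=
    fun ℓ hz => (hvz3 ℓ) ▸ factorization_le_of_natCast_dvd (pow_ne_zero _ hz) hGd₃ ℓ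
  -- `v_ℓ(G)` is the valuation of one of the non-zero terms
  have htri : ∀ ℓ, G.factorization ℓ = A.natAbs.factorization ℓ + L * x.natAbs.factorization ℓ ∨
      (y ≠ 0 ∧ G.factorization ℓ = 2 * y.natAbs.factorization ℓ) ∨
      (z ≠ 0 ∧ G.factorization ℓ = 3 * z.natAbs.factorization ℓ) := by
    intro ℓ
    rcases factorization_gcd_eq_or (w := z ^ 3) hG₁z ℓ with h | ⟨hz3, h⟩
    · rw [Int.natAbs_natCast] at h
      rcases factorization_gcd_eq_or (w := y ^ 2) hAxL ℓ with h' | ⟨hy2, h'⟩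
      · left; rw [hG, h, h', hvAx]
      · right; left
        exact ⟨fun hy => hy2 (by rw [hy]; ring), by rw [hG, h, h', hvy2]⟩
    · right; right
      exact ⟨fun hz => hz3 (by rw [hz]; ring), by rw [hG, h, hvz3]⟩
  -- the primes of `G` and of `A` lie in `T`
  have hGT : ∀ p : ℕ, p.Prime → p ∣ G → p ∈ T := fun p hp hpG =>
    mem_of_prime_dvd_gcd hAT hcop hp hpG
  have hvA0 : ∀ p : ℕ, p.Prime → p ∉ T → A.natAbs.factorization p = 0 := fun p hp hpT =>
    Nat.factorization_eq_zero_of_not_dvd fun h => hpT (hAT p hp (Int.natCast_dvd.mpr h))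
  have hm0 : ∀ p : ℕ, p.Prime → p ∉ T → G.factorization p = 0 := fun p hp hpT =>
    Nat.factorization_eq_zero_of_not_dvd fun h => hpT (hGT p hp h)
  -- the finite set of primes at which everything happens
  set P : Finset ℕ := T ∪ ((A * x ^ L).natAbs.primeFactors ∪ y.natAbs.primeFactors ∪
    z.natAbs.primeFactors) with hP
  have hTP : T ⊆ P := Finset.subset_union_left
  have hPprime : ∀ ℓ ∈ P, ℓ.Prime := by
    intro ℓ hℓ
    simp only [hP, Finset.mem_union] at hℓ
    rcases hℓ with h | (h | h) | h
    · exact hT ℓ h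
    all_goals exact Nat.prime_of_mem_primeFactors h
  have hAxP : (A * x ^ L).natAbs.primeFactors ⊆ P := by
    intro q hq; simp only [hP, Finset.mem_union]; tauto
  have hAP : A.natAbs.primeFactors ⊆ P := by
    refine subset_trans (fun q hq => ?_) hAxP
    rw [Int.natAbs_mul, Nat.primeFactors_mul (Int.natAbs_ne_zero.mpr hA)
      (by rw [Int.natAbs_pow]; exact pow_ne_zero _ (Int.natAbs_ne_zero.mpr hx))]
    exact Finset.mem_union_left _ hq
  have hxP : x.natAbs.primeFactors ⊆ P := by
    refine subset_trans (fun q hq => ?_) hAxP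
    rw [Int.natAbs_mul, Int.natAbs_pow, Nat.primeFactors_mul (Int.natAbs_ne_zero.mpr hA)
      (pow_ne_zero _ (Int.natAbs_ne_zero.mpr hx)), Nat.primeFactors_pow _ hL0]
    exact Finset.mem_union_right _ hq
  have hyP : y.natAbs.primeFactors ⊆ P := by
    intro q hq; simp only [hP, Finset.mem_union]; tauto
  have hzP : z.natAbs.primeFactors ⊆ P := by
    intro q hq; simp only [hP, Finset.mem_union]; tauto
  have hGP : G.primeFactors ⊆ P :=
    (Nat.primeFactors_mono (Int.natCast_dvd.mp hGd₁) (Int.natAbs_ne_zero.mpr hAxL)).trans hAxP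
  -- the exponents `e₁ = v(A) + L v(x) − m`, `e₂ = 2 v(y) − m`, `e₃ = 3 v(z) − m`
  set e₁ : ℕ → ℕ := fun ℓ => A.natAbs.factorization ℓ + L * x.natAbs.factorization ℓ -
    G.factorization ℓ with he₁
  set e₂ : ℕ → ℕ := fun ℓ => 2 * y.natAbs.factorization ℓ - G.factorization ℓ with he₂
  set e₃ : ℕ → ℕ := fun ℓ => 3 * z.natAbs.factorization ℓ - G.factorization ℓ with he₃
  have he₁T : ∀ p : ℕ, p.Prime → p ∉ T → e₁ p = L * x.natAbs.factorization p := by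
    intro p hp hpT; simp only [he₁, hvA0 p hp hpT, hm0 p hp hpT, zero_add, Nat.sub_zero]
  have he₂T : ∀ p : ℕ, p.Prime → p ∉ T → e₂ p = 2 * y.natAbs.factorization p := by
    intro p hp hpT; simp only [he₂, hm0 p hp hpT, Nat.sub_zero]
  have he₃T : ∀ p : ℕ, p.Prime → p ∉ T → e₃ p = 3 * z.natAbs.factorization p := by
    intro p hp hpT; simp only [he₃, hm0 p hp hpT, Nat.sub_zero]
  -- the three term identities `G · (new term) = old term`
  have hrepG : (G : ℤ) = ∏ ℓ ∈ P, (ℓ : ℤ) ^ G.factorization ℓ := by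
    rw [← natCast_prod_pow]
    exact_mod_cast nat_eq_prod_pow_factorization hG0 hGP
  have hU : (G : ℤ) ≠ 0 := by exact_mod_cast hG0
  have hrepA := eq_sign_mul_prod_pow_factorization A hAP
  have hrepx := eq_sign_mul_prod_pow_factorization x hxP
  have hrepy := eq_sign_mul_prod_pow_factorization y hyP
  have hrepz := eq_sign_mul_prod_pow_factorization z hzP
  have T1 := term_identity P A.sign x.sign A.natAbs.factorization x.natAbs.factorization
    G.factorization e₁ hL0 (Or.inr fun ℓ _ => by
      simp only [he₁]; exact Nat.add_sub_cancel' (hm₁ ℓ))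
  rw [← hrepA, ← hrepx, ← hrepG] at T1
  have T2 := term_identity P 1 y.sign (fun _ => 0) y.natAbs.factorization
    G.factorization e₂ two_ne_zero (by
      by_cases hy : y = 0
      · left; simp [hy]
      · right; intro ℓ _; simp only [he₂, zero_add]; exact Nat.add_sub_cancel' (hm₂ ℓ hy))
  simp only [pow_zero, Finset.prod_const_one, one_mul] at T2
  rw [← hrepy, ← hrepG] at T2
  have T3 := term_identity P 1 z.sign (fun _ => 0) z.natAbs.factorization
    G.factorization e₃ three_ne_zero (by
      by_cases hz : z = 0
      · left; simp [hz]
      · right; intro ℓ _; simp only [he₃, zero_add]; exact Nat.add_sub_cancel' (hm₃ ℓ hz))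
  simp only [pow_zero, Finset.prod_const_one, one_mul] at T3
  rw [← hrepz, ← hrepG] at T3
  refine ⟨A.sign * ∏ ℓ ∈ P, (ℓ : ℤ) ^ (e₁ ℓ % L), ∏ ℓ ∈ P, (ℓ : ℤ) ^ (e₂ ℓ % 2),
    ∏ ℓ ∈ P, (ℓ : ℤ) ^ (e₃ ℓ % 3), x.sign * ∏ ℓ ∈ P, (ℓ : ℤ) ^ (e₁ ℓ / L),
    y.sign * ∏ ℓ ∈ P, (ℓ : ℤ) ^ (e₂ ℓ / 2), z.sign * ∏ ℓ ∈ P, (ℓ : ℤ) ^ (e₃ ℓ / 3),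
    mul_ne_zero (Int.sign_eq_zero_iff_zero.not.mpr hA) (prod_pow_ne_zero hPprime _),
    prod_pow_ne_zero hPprime _, prod_pow_ne_zero hPprime _, ?_, ?_, ?_, ?_, ?_,
    mul_ne_zero (Int.sign_eq_zero_iff_zero.not.mpr hx) (prod_pow_ne_zero hPprime _), ?_, T2, T3⟩
  · -- `|A'| ≤ ∏_{ℓ ∈ T} ℓ^L`
    rw [Int.natAbs_mul, Int.natAbs_sign_of_ne_zero hA, one_mul, natAbs_prod_pow]
    refine prod_pow_le_prod_pow hTP hT (fun ℓ hℓ hℓT => ?_) (fun ℓ _ => (Nat.mod_lt _ hLpos).le)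
    rw [he₁T ℓ (hPprime ℓ hℓ) hℓT, Nat.mul_mod_right]
  · -- `|B'| ≤ ∏_{ℓ ∈ T} ℓ^L`
    rw [natAbs_prod_pow]
    refine prod_pow_le_prod_pow hTP hT (fun ℓ hℓ hℓT => ?_)
      (fun ℓ _ => (Nat.mod_lt _ two_pos).le.trans (by omega))
    rw [he₂T ℓ (hPprime ℓ hℓ) hℓT, Nat.mul_mod_right]
  · -- `|C'| ≤ ∏_{ℓ ∈ T} ℓ^L`
    rw [natAbs_prod_pow]
    refine prod_pow_le_prod_pow hTP hT (fun ℓ hℓ hℓT => ?_)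
      (fun ℓ _ => (Nat.mod_lt _ three_pos).le.trans hL)
    rw [he₃T ℓ (hPprime ℓ hℓ) hℓT, Nat.mul_mod_right]
  · -- properness: at `p` the minimum `m_p` is attained by a non-zero term
    rintro p hp ⟨hpx, hpy, hpz⟩
    have hsx : IsUnit x.sign := Int.isUnit_iff_natAbs_eq.mpr (Int.natAbs_sign_of_ne_zero hx)
    rw [hsx.dvd_mul_left, prime_dvd_prod_pow_iff hPprime hp] at hpx
    rcases htri p with h1 | ⟨hy0, h2⟩ | ⟨hz0, h3⟩
    · refine hpx.2 ?_
      have : e₁ p = 0 := by simp only [he₁, h1, Nat.sub_self]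
      rw [this, Nat.zero_div]
    · have hsy : IsUnit y.sign := Int.isUnit_iff_natAbs_eq.mpr (Int.natAbs_sign_of_ne_zero hy0)
      rw [hsy.dvd_mul_left, prime_dvd_prod_pow_iff hPprime hp] at hpy
      refine hpy.2 ?_
      have : e₂ p = 0 := by simp only [he₂, h2, Nat.sub_self]
      rw [this, Nat.zero_div]
    · have hsz : IsUnit z.sign := Int.isUnit_iff_natAbs_eq.mpr (Int.natAbs_sign_of_ne_zero hz0)
      rw [hsz.dvd_mul_left, prime_dvd_prod_pow_iff hPprime hp] at hpz
      refine hpz.2 ?_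
      have : e₃ p = 0 := by simp only [he₃, h3, Nat.sub_self]
      rw [this, Nat.zero_div]
  · -- the equation, i.e. the original one divided by `G`
    refine mul_left_cancel₀ hU ?_
    rw [mul_add, T1, T2, T3]
    exact heq
  · -- a prime `p ∉ T` dividing `x` divides `x'`
    intro p hp hpT hpx
    refine Dvd.dvd.mul_left ((prime_dvd_prod_pow_iff hPprime hp _).mpr ⟨?_, ?_⟩) _
    · exact hxP (Nat.mem_primeFactors.mpr ⟨hp, Int.natCast_dvd.mp hpx, Int.natAbs_ne_zero.mpr hx⟩)
    · rw [he₁T p hp hpT, Nat.mul_div_cancel_left _ hLpos]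
      exact (hp.factorization_pos_of_dvd (Int.natAbs_ne_zero.mpr hx) (Int.natCast_dvd.mp hpx)).ne'

/-! ### Darmon–Granville for signature `(L, 2, 3)`: the two bounds -/

/-- `gcd(a, b, c) = 1` in the form used by `darmonGranville1995_thm_2`
(`({a, b, c} : Finset ℤ).gcd id = 1`) as soon as no prime divides `a`, `b` and `c`. [folklore] -/
theorem gcd_eq_one_of_forall_prime {a b c : ℤ}
    (h : ∀ p : ℕ, p.Prime → ¬ ((p : ℤ) ∣ a ∧ (p : ℤ) ∣ b ∧ (p : ℤ) ∣ c)) :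
    ({a, b, c} : Finset ℤ).gcd id = 1 := by
  have hda : ({a, b, c} : Finset ℤ).gcd id ∣ a := Finset.gcd_dvd (f := id) (by simp)
  have hdb : ({a, b, c} : Finset ℤ).gcd id ∣ b := Finset.gcd_dvd (f := id) (by simp)
  have hdc : ({a, b, c} : Finset ℤ).gcd id ∣ c := Finset.gcd_dvd (f := id) (by simp)
  have hd1 : (({a, b, c} : Finset ℤ).gcd id).natAbs = 1 := by
    by_contra hne
    obtain ⟨p, hp, hpd⟩ := Nat.exists_prime_and_dvd hne
    have hpd' : (p : ℤ) ∣ ({a, b, c} : Finset ℤ).gcd id := Int.natCast_dvd.mpr hpd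
    exact h p hp ⟨hpd'.trans hda, hpd'.trans hdb, hpd'.trans hdc⟩
  rw [← Finset.normalize_gcd, normalize_eq_one]
  exact Int.isUnit_iff_natAbs_eq.mpr hd1

/-- **The Diophantine input of Lemma 6.10, from the finiteness of the proper solutions of the
equations `A x^L + B y² = C z³` of the ONE signature `(L, 2, 3)`** (the conclusion of
[DarmonGranville1995, Thm 2] at that signature, taken as the hypothesis `hFin`; `L ≥ 3`). For a
finite set of primes `T` there are `B₀, B₁` depending only on `L, T` such that for every `A ≠ 0`
supported on `T` and every solution of `A x^L + y² = z³` with `x ≠ 0` whose common prime divisors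
lie in `T`: every prime `p ∉ T` dividing `x` satisfies `p ≤ B₀`, and `y² ≤ G · B₁`,
`|z|³ ≤ G · B₁` where `G = gcd(A x^L, y², z³)`. Proof: the finitely many normalised equations of
`exists_proper_solution` (`0 < |A'|, |B'|, |C'| ≤ ∏ ℓ^L`) have altogether finitely many proper
solutions `(x', y', z')`; `p` divides `x' ≠ 0`, and `y² = G B' y'²`, `z³ = G C' z'³`. This replaces
the appeal to Lemma 6.9 in the printed proof (see the module docstring); isolating the signature
`(L, 2, 3)` lets the per-signature form of Darmon–Granville's theorem (one `(2, 3, r)` covering and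
Faltings' theorem, `AbcDarmonGranvilleSignatureReduction`) be fed in, see
`PastenValuationProductLemma610OfFaltings`.
[cite: PastenShimura2024, Lemma 6.10 (proof) and Lemma 6.9, p. 22] -/
theorem exists_bounds_of_finite_properSolutions {L : ℕ} (hL : 3 ≤ L)
    (hFin : ∀ A B C : ℤ, A ≠ 0 → B ≠ 0 → C ≠ 0 →
      {t : ℤ × ℤ × ℤ | ({t.1, t.2.1, t.2.2} : Finset ℤ).gcd id = 1 ∧
        A * t.1 ^ L + B * t.2.1 ^ 2 = C * t.2.2 ^ 3}.Finite)
    {T : Finset ℕ} (hT : ∀ ℓ ∈ T, ℓ.Prime) :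
    ∃ B₀ B₁ : ℕ, ∀ (A x y z : ℤ), A ≠ 0 → x ≠ 0 →
      (∀ p : ℕ, p.Prime → (p : ℤ) ∣ A → p ∈ T) →
      (∀ p : ℕ, p.Prime → (p : ℤ) ∣ x → (p : ℤ) ∣ y → (p : ℤ) ∣ z → p ∈ T) →
      A * x ^ L + y ^ 2 = z ^ 3 →
      (∀ p : ℕ, p.Prime → p ∉ T → (p : ℤ) ∣ x → p ≤ B₀) ∧
      (y ^ 2).natAbs ≤ Int.gcd (Int.gcd (A * x ^ L) (y ^ 2)) (z ^ 3) * B₁ ∧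
      (z ^ 3).natAbs ≤ Int.gcd (Int.gcd (A * x ^ L) (y ^ 2)) (z ^ 3) * B₁ := by
  classical
  -- the finitely many admissible coefficient triples
  set M : ℕ := ∏ ℓ ∈ T, ℓ ^ L with hM
  set cf : Set (ℤ × ℤ × ℤ) := {c | (c.1.natAbs ≤ M ∧ c.2.1.natAbs ≤ M ∧ c.2.2.natAbs ≤ M) ∧
      c.1 ≠ 0 ∧ c.2.1 ≠ 0 ∧ c.2.2 ≠ 0} with hcf
  have hbox : ∀ w : ℤ, w.natAbs ≤ M → w ∈ Set.Icc (-(M : ℤ)) M := fun w hw => by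
    have : |w| ≤ (M : ℤ) := by rw [← Int.natCast_natAbs]; exact_mod_cast hw
    exact abs_le.mp this
  have hcf_fin : cf.Finite := by
    refine ((Set.finite_Icc (-(M : ℤ)) M).prod ((Set.finite_Icc (-(M : ℤ)) M).prod
      (Set.finite_Icc (-(M : ℤ)) M))).subset ?_
    rintro ⟨a, b, c⟩ ⟨⟨ha, hb, hc⟩, -⟩
    exact ⟨hbox a ha, hbox b hb, hbox c hc⟩
  -- each has finitely many proper solutions (signature `(L, 2, 3)`)
  set Sol : Set (ℤ × ℤ × ℤ) := ⋃ c ∈ cf, {t : ℤ × ℤ × ℤ |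
      ({t.1, t.2.1, t.2.2} : Finset ℤ).gcd id = 1 ∧
        c.1 * t.1 ^ L + c.2.1 * t.2.1 ^ 2 = c.2.2 * t.2.2 ^ 3} with hSol
  have hfin : Sol.Finite :=
    hcf_fin.biUnion fun c hc => hFin c.1 c.2.1 c.2.2 hc.2.1 hc.2.2.1 hc.2.2.2
  obtain ⟨B₀, hB₀⟩ := (hfin.image fun t => t.1.natAbs).bddAbove
  obtain ⟨K₀, hK₀⟩ := (hfin.image fun t => max t.2.1.natAbs t.2.2.natAbs).bddAbove
  refine ⟨B₀, M * (K₀ + 1) ^ 3, fun A x y z hA hx hAT hcop heq => ?_⟩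
  obtain ⟨A', B', C', x', y', z', hA', hB', hC', hA'M, hB'M, hC'M, hprop, heq', hx', htrans,
    hy2, hz3⟩ := exists_proper_solution hT (by omega) hA hx hAT hcop heq
  have hmem : (x', y', z') ∈ Sol := by
    simp only [hSol, Set.mem_iUnion]
    exact ⟨(A', B', C'), ⟨⟨hA'M, hB'M, hC'M⟩, hA', hB', hC'⟩, gcd_eq_one_of_forall_prime hprop, heq'⟩
  have hle : x'.natAbs ≤ B₀ := hB₀ ⟨(x', y', z'), hmem, rfl⟩
  have hK : max y'.natAbs z'.natAbs ≤ K₀ := hK₀ ⟨(x', y', z'), hmem, rfl⟩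
  have hy' : y'.natAbs ≤ K₀ + 1 := (le_max_left _ _).trans (hK.trans (Nat.le_succ _))
  have hz' : z'.natAbs ≤ K₀ + 1 := (le_max_right _ _).trans (hK.trans (Nat.le_succ _))
  refine ⟨fun p hp hpT hpx => ?_, ?_, ?_⟩
  · exact (Nat.le_of_dvd (Int.natAbs_pos.mpr hx')
      (Int.natCast_dvd.mp (htrans p hp hpT hpx))).trans hle
  · have h : (y ^ 2).natAbs =
        Int.gcd (Int.gcd (A * x ^ L) (y ^ 2)) (z ^ 3) * (B'.natAbs * y'.natAbs ^ 2) := by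
      conv_lhs => rw [← hy2]
      rw [Int.natAbs_mul, Int.natAbs_natCast, Int.natAbs_mul, Int.natAbs_pow]
    rw [h]
    refine Nat.mul_le_mul_left _ (Nat.mul_le_mul hB'M ?_)
    calc y'.natAbs ^ 2 ≤ (K₀ + 1) ^ 2 := Nat.pow_le_pow_left hy' 2
      _ ≤ (K₀ + 1) ^ 3 := Nat.pow_le_pow_right (Nat.succ_pos _) (by norm_num)
  · have h : (z ^ 3).natAbs =
        Int.gcd (Int.gcd (A * x ^ L) (y ^ 2)) (z ^ 3) * (C'.natAbs * z'.natAbs ^ 3) := by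
      conv_lhs => rw [← hz3]
      rw [Int.natAbs_mul, Int.natAbs_natCast, Int.natAbs_mul, Int.natAbs_pow]
    rw [h]
    exact Nat.mul_le_mul_left _ (Nat.mul_le_mul hC'M (Nat.pow_le_pow_left hz' 3))

open Literature.NumberTheory.DiophantineGeometry in
/-- **The Diophantine input of Lemma 6.10, from [DarmonGranville1995, Thm 2].** For a finite set
of primes `T` and `L ≥ 7` there are `B₀, B₁` depending only on `L, T` such that for every `A ≠ 0`
supported on `T` and every solution of `A x^L + y² = z³` with `x ≠ 0` whose common prime divisors
lie in `T`: every prime `p ∉ T` dividing `x` satisfies `p ≤ B₀`, and `y² ≤ G · B₁`,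
`|z|³ ≤ G · B₁` where `G = gcd(A x^L, y², z³)`. Proof: the signature `(L, 2, 3)` is hyperbolic
(`1/L + 1/2 + 1/3 < 1` iff `L ≥ 7`; "Since `1/2 + 1/3 + 1/L < 1`", p. 22), so Theorem 2 supplies
the hypothesis of `exists_bounds_of_finite_properSolutions`.
[cite: PastenShimura2024, Lemma 6.10 (proof) and Lemma 6.9, p. 22] -/
theorem exists_bounds_of_darmonGranville (hDG : darmonGranville1995_thm_2) {T : Finset ℕ}
    (hT : ∀ ℓ ∈ T, ℓ.Prime) {L : ℕ} (hL : 7 ≤ L) :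
    ∃ B₀ B₁ : ℕ, ∀ (A x y z : ℤ), A ≠ 0 → x ≠ 0 →
      (∀ p : ℕ, p.Prime → (p : ℤ) ∣ A → p ∈ T) →
      (∀ p : ℕ, p.Prime → (p : ℤ) ∣ x → (p : ℤ) ∣ y → (p : ℤ) ∣ z → p ∈ T) →
      A * x ^ L + y ^ 2 = z ^ 3 →
      (∀ p : ℕ, p.Prime → p ∉ T → (p : ℤ) ∣ x → p ≤ B₀) ∧
      (y ^ 2).natAbs ≤ Int.gcd (Int.gcd (A * x ^ L) (y ^ 2)) (z ^ 3) * B₁ ∧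
      (z ^ 3).natAbs ≤ Int.gcd (Int.gcd (A * x ^ L) (y ^ 2)) (z ^ 3) * B₁ :=
  have hhyp : 2 * 3 + 3 * L + L * 2 < L * 2 * 3 := by nlinarith
  exists_bounds_of_finite_properSolutions (by omega)
    (fun A B C hA hB hC => hDG A B C hA hB hC hhyp) hT

/-! ### The elliptic-curve side: a global minimal equation over `ℤ` -/

open IsDedekindDomain WeierstrassCurve in
/-- **Minimality at every prime, uniform form** (Silverman AEC Ex. 8.21 / VII.1 Remark 1.1, the
tree's `not_pow_dvd_c₄_c₆_of_isMinimalAt`, `…_two`, `…_three`): a Weierstrass equation over `ℤ`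
with `Δ ≠ 0`, minimal at every place of `ℤ`, has `p⁸ ∤ c₄` or `p¹¹ ∤ c₆` for every prime `p`
(the printed thresholds are `(4, 6)` for `p ≥ 5`, `(8, 11)` for `p = 2`, `(5, 9)` for `p = 3`).
[cite: SilvermanAEC2009, Ex. 8.21] -/
theorem not_pow_dvd_c₄_c₆ (W₀ : WeierstrassCurve ℤ) (hΔ : W₀.Δ ≠ 0)
    (hmin : ∀ v : HeightOneSpectrum ℤ, (W₀.baseChange ℚ).IsMinimalAt v) {p : ℕ} (hp : p.Prime) :
    ¬ ((p : ℤ) ^ 8 ∣ W₀.c₄ ∧ (p : ℤ) ^ 11 ∣ W₀.c₆) := by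
  rintro ⟨h4, h6⟩
  set v : HeightOneSpectrum ℤ := (Rat.HeightOneSpectrum.primesEquiv (R := ℤ)).symm ⟨p, hp⟩ with hv
  have hgen : Rat.HeightOneSpectrum.natGenerator v = p := natGenerator_primesEquiv_symm p hp
  by_cases h2 : p = 2
  · subst h2
    exact not_pow_dvd_c₄_c₆_of_isMinimalAt_two v W₀ hΔ (hmin v) hgen
      ⟨by exact_mod_cast h4, by exact_mod_cast h6⟩
  by_cases h3 : p = 3
  · subst h3
    exact not_pow_dvd_c₄_c₆_of_isMinimalAt_three v W₀ hΔ (hmin v) hgen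
      ⟨(pow_dvd_pow (3 : ℤ) (by norm_num : 5 ≤ 8)).trans (by exact_mod_cast h4),
        (pow_dvd_pow (3 : ℤ) (by norm_num : 9 ≤ 11)).trans (by exact_mod_cast h6)⟩
  have h4' : p ≠ 4 := fun h => by norm_num [h] at hp
  have h5 : 5 ≤ p := by have := hp.two_le; omega
  have key := not_pow_dvd_c₄_c₆_of_isMinimalAt v W₀ hΔ (hmin v) (hgen ▸ h5)
  rw [hgen] at key
  exact key ⟨(pow_dvd_pow _ (by norm_num)).trans h4, (pow_dvd_pow _ (by norm_num)).trans h6⟩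

open IsDedekindDomain WeierstrassCurve in
/-- **The Diophantine data of a global minimal equation** (steps 2–3 of the module docstring; the
first two sentences of the printed proof of Lemma 6.10, p. 22). Let `W₀/ℤ` be minimal at every
prime with `Δ ≠ 0`, semi-stable away from `S` in the sense `p² ∤ N` for primes `p ∉ S`, and
`|Δ(W₀)| = n k^L` (`L ≠ 0`) with the primes of `n` in `S`; let `T ⊇ (primes of S) ∪ {2, 3}`. Then
with `A := 1728 · sign(Δ) · n`: `A ≠ 0`, `k ≠ 0`, `A` is supported on `T`, every common prime
divisor of `k, c₆, c₄` lies in `T` (such a prime `p ∉ S` divides `Δ` and `c₄`, so `E` is additive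
at `p` and `p² ∣ N`, Silverman AEC Ex. 8.21; the tree's `sq_dvd_conductorNorm_of_dvd_Δ_of_dvd_c₄`),
and `A k^L + c₆² = c₄³` (`1728 Δ = c₄³ − c₆²`, Mathlib `WeierstrassCurve.c_relation`).
[cite: PastenShimura2024, Lemma 6.10 (proof), p. 22] -/
theorem dioph_setup {S T : Finset ℕ} (hST : ∀ p : ℕ, p.Prime → p ∈ S → p ∈ T)
    (h2T : 2 ∈ T) (h3T : 3 ∈ T) {L : ℕ} (hL0 : L ≠ 0)
    (W₀ : WeierstrassCurve ℤ) (hΔ0 : W₀.Δ ≠ 0)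
    (hmin : ∀ v : HeightOneSpectrum ℤ, (W₀.baseChange ℚ).IsMinimalAt v)
    (hS : ∀ p : ℕ, p.Prime → p ∉ S → ¬ p ^ 2 ∣ (W₀.baseChange ℚ).conductorNorm ℤ)
    {n k : ℕ} (hn : ∀ q : ℕ, q.Prime → q ∣ n → q ∈ S) (hΔ : W₀.Δ.natAbs = n * k ^ L) :
    (1728 * W₀.Δ.sign * n : ℤ) ≠ 0 ∧ (k : ℤ) ≠ 0 ∧
      (∀ p : ℕ, p.Prime → (p : ℤ) ∣ 1728 * W₀.Δ.sign * n → p ∈ T) ∧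
      (∀ p : ℕ, p.Prime → (p : ℤ) ∣ k → (p : ℤ) ∣ W₀.c₆ → (p : ℤ) ∣ W₀.c₄ → p ∈ T) ∧
      1728 * W₀.Δ.sign * n * (k : ℤ) ^ L + W₀.c₆ ^ 2 = W₀.c₄ ^ 3 := by
  -- `|Δ(W₀)| = n k^L` with `n, k ≠ 0`
  have hn0 : n ≠ 0 := by
    rintro rfl
    rw [zero_mul] at hΔ
    exact hΔ0 (Int.natAbs_eq_zero.mp hΔ)
  have hk0 : k ≠ 0 := by
    rintro rfl
    rw [zero_pow hL0, mul_zero] at hΔ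
    exact hΔ0 (Int.natAbs_eq_zero.mp hΔ)
  have hΔeq : W₀.Δ = W₀.Δ.sign * ((n : ℤ) * (k : ℤ) ^ L) := by
    have h := Int.sign_mul_natAbs W₀.Δ
    rw [hΔ] at h
    push_cast at h
    exact h.symm
  refine ⟨mul_ne_zero (mul_ne_zero (by norm_num) (Int.sign_eq_zero_iff_zero.not.mpr hΔ0))
      (by exact_mod_cast hn0), by exact_mod_cast hk0, fun p hp hpd => ?_,
    fun p hp hpk _ hpc => ?_, ?_⟩
  · -- the coefficient `A` is supported on `T`
    have hpz : Prime (p : ℤ) := Nat.prime_iff_prime_int.mp hp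
    rcases hpz.dvd_or_dvd hpd with h | h
    · rcases hpz.dvd_or_dvd h with h | h
      · have h' : p ∣ 2 ^ 6 * 3 ^ 3 := by norm_num; exact_mod_cast h
        rcases (Nat.Prime.dvd_mul hp).mp h' with h2 | h3
        · rw [(Nat.prime_dvd_prime_iff_eq hp Nat.prime_two).mp (hp.dvd_of_dvd_pow h2)]
          exact h2T
        · rw [(Nat.prime_dvd_prime_iff_eq hp Nat.prime_three).mp (hp.dvd_of_dvd_pow h3)]
          exact h3T
      · exfalso
        have hu : IsUnit W₀.Δ.sign :=
          Int.isUnit_iff_natAbs_eq.mpr (Int.natAbs_sign_of_ne_zero hΔ0)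
        have := Int.isUnit_iff_natAbs_eq.mp (isUnit_of_dvd_unit h hu)
        rw [Int.natAbs_natCast] at this
        exact hp.ne_one this
    · exact hST p hp (hn p hp (Int.natCast_dvd_natCast.mp h))
  · -- common prime divisors of `k`, `c₆`, `c₄` lie in `T` (semi-stability away from `S`)
    by_contra hpT
    have hpS : p ∉ S := fun h => hpT (hST p hp h)
    have hpΔ : (p : ℤ) ∣ W₀.Δ := by
      rw [hΔeq]
      exact dvd_mul_of_dvd_right (dvd_mul_of_dvd_right (dvd_pow hpk hL0) _) _
    exact hS p hp hpS (sq_dvd_conductorNorm_of_dvd_Δ_of_dvd_c₄ W₀ hΔ0 hmin hp hpΔ hpc)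
  · -- the equation, from `1728 Δ = c₄³ − c₆²`
    have h := W₀.c_relation
    rw [hΔeq] at h
    linear_combination h

open IsDedekindDomain WeierstrassCurve in
/-- **The gcd of the three terms is bounded for a minimal equation** (the role of minimality in
"a finite list of possible quantities `c₄` and `c₆`", p. 22): in the situation of `dioph_setup`,
`G = gcd(A k^L, c₆², c₄³) ≤ ∏_{p ∈ T} p²¹`. Indeed the primes of `G` lie in `T`
(`mem_of_prime_dvd_gcd`), and at a prime `p` minimality gives `p⁸ ∤ c₄` (then `c₄ ≠ 0`,
`v_p(G) ≤ 3 v_p(c₄) ≤ 21`) or `p¹¹ ∤ c₆` (then `v_p(G) ≤ 2 v_p(c₆) ≤ 20`)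
(`not_pow_dvd_c₄_c₆`). [cite: SilvermanAEC2009, Ex. 8.21] -/
theorem gcd_le_of_isMinimalAt {T : Finset ℕ} (hT : ∀ ℓ ∈ T, ℓ.Prime) {L : ℕ} {A : ℤ} {k : ℕ}
    (W₀ : WeierstrassCurve ℤ) (hΔ0 : W₀.Δ ≠ 0)
    (hmin : ∀ v : HeightOneSpectrum ℤ, (W₀.baseChange ℚ).IsMinimalAt v)
    (hA : A ≠ 0) (hk : (k : ℤ) ≠ 0)
    (hAT : ∀ p : ℕ, p.Prime → (p : ℤ) ∣ A → p ∈ T)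
    (hcop : ∀ p : ℕ, p.Prime → (p : ℤ) ∣ k → (p : ℤ) ∣ W₀.c₆ → (p : ℤ) ∣ W₀.c₄ → p ∈ T) :
    Int.gcd (Int.gcd (A * (k : ℤ) ^ L) (W₀.c₆ ^ 2)) (W₀.c₄ ^ 3) ≤ ∏ p ∈ T, p ^ 21 := by
  classical
  set G : ℕ := Int.gcd (Int.gcd (A * (k : ℤ) ^ L) (W₀.c₆ ^ 2)) (W₀.c₄ ^ 3) with hG
  have hAk : A * (k : ℤ) ^ L ≠ 0 := mul_ne_zero hA (pow_ne_zero _ hk)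
  have hG0 : G ≠ 0 := by
    intro h
    have h1 := (Int.gcd_eq_zero_iff.mp h).1
    exact hAk (Int.gcd_eq_zero_iff.mp (by exact_mod_cast h1)).1
  have hGT : G.primeFactors ⊆ T := fun p hp =>
    mem_of_prime_dvd_gcd hAT hcop (Nat.prime_of_mem_primeFactors hp) (Nat.dvd_of_mem_primeFactors hp)
  -- `v_p(G) ≤ 21` at every prime
  have hexp : ∀ p ∈ T, G.factorization p ≤ 21 := by
    intro p hpT
    have hp := hT p hpT
    have hGd₂ : (G : ℤ) ∣ W₀.c₆ ^ 2 := (Int.gcd_dvd_left _ _).trans (Int.gcd_dvd_right _ _)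
    have hGd₃ : (G : ℤ) ∣ W₀.c₄ ^ 3 := Int.gcd_dvd_right _ _
    by_cases h8 : (p : ℤ) ^ 8 ∣ W₀.c₄
    · have h11 : ¬ (p : ℤ) ^ 11 ∣ W₀.c₆ := fun h => not_pow_dvd_c₄_c₆ W₀ hΔ0 hmin hp ⟨h8, h⟩
      have hc6 : W₀.c₆ ≠ 0 := fun h => h11 (by rw [h]; exact dvd_zero _)
      have hv : W₀.c₆.natAbs.factorization p ≤ 10 := by
        have := (hp.pow_dvd_iff_le_factorization (Int.natAbs_ne_zero.mpr hc6)).not.mp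
          (fun h => h11 (Int.natCast_dvd.mpr (by exact_mod_cast h)))
        omega
      have := factorization_le_of_natCast_dvd (pow_ne_zero _ hc6) hGd₂ p
      rw [Int.natAbs_pow, Nat.factorization_pow, Finsupp.smul_apply, smul_eq_mul] at this
      omega
    · have hc4 : W₀.c₄ ≠ 0 := fun h => h8 (by rw [h]; exact dvd_zero _)
      have hv : W₀.c₄.natAbs.factorization p ≤ 7 := by
        have := (hp.pow_dvd_iff_le_factorization (Int.natAbs_ne_zero.mpr hc4)).not.mp
          (fun h => h8 (Int.natCast_dvd.mpr (by exact_mod_cast h)))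
        omega
      have := factorization_le_of_natCast_dvd (pow_ne_zero _ hc4) hGd₃ p
      rw [Int.natAbs_pow, Nat.factorization_pow, Finsupp.smul_apply, smul_eq_mul] at this
      omega
  calc G = ∏ p ∈ T, p ^ G.factorization p := nat_eq_prod_pow_factorization hG0 hGT
    _ ≤ ∏ p ∈ T, p ^ 21 := Finset.prod_le_prod (fun _ _ => Nat.zero_le _)
        fun p hp => Nat.pow_le_pow_right (hT p hp).pos (hexp p hp)

end PastenLemma610

/-! ### Lemma 6.10 -/

open IsDedekindDomain WeierstrassCurve UniqueFactorizationMonoid in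
/-- **Pasten's Lemma 6.10 at ONE exponent `L`, from the finiteness of the proper solutions of the
equations `A x^L + B y² = C z³`** (the conclusion of [DarmonGranville1995, Thm 2] at the signature
`(L, 2, 3)`, hypothesis `hFin`; `L ≥ 3`): for every finite set `S` there is `N₀(L, S)` such that no
elliptic curve `E/ℚ` semi-stable away from `S` (`p² ∤ N_E` for primes `p ∉ S`) with `N_E ≥ N₀`
has `|Δ_E| = n k^L` with all prime factors of `n` in `S`. Proof as printed [PastenShimura2024,
§6.5, Lemma 6.10, p. 22] (see the module docstring for the two bookkeeping deviations): global
minimal equation `W₀/ℤ` (AEC VIII.8.3); `dioph_setup` makes `(k, c₆, c₄)` a solution of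
`A x^L + y² = z³`, `A = 1728 · sign(Δ) · n`, with common primes in `T = S ∪ {2,3}`; normalising
(`PastenLemma610.exists_proper_solution`) and applying `hFin` to the finitely many resulting
equations (`PastenLemma610.exists_bounds_of_finite_properSolutions`) bounds every prime `p ∉ T`
of `k`; since every prime of `N_E` divides `|Δ_E| = n k^L` (`radical_conductorNorm_eq_holds`) and
`f_p ≤ 8` (`conductorExponent_le_eight_holds`), `N_E` is at most `∏ p⁸` over a finite set of
primes depending only on `L` and `S`. The per-exponent form is what the per-signature
Darmon–Granville theorem of `AbcDarmonGranvilleSignatureReduction` feeds (one `(2, 3, r)` covering,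
`r ∣ L`, and Faltings' theorem: `PastenValuationProductLemma610OfFaltings`).
[cite: PastenShimura2024, Lemma 6.10 (§6.5, p. 22)] -/
theorem PastenLemma610.conductor_bounded_of_finite_properSolutions {L : ℕ} (hL : 3 ≤ L)
    (hFin : ∀ A B C : ℤ, A ≠ 0 → B ≠ 0 → C ≠ 0 →
      {t : ℤ × ℤ × ℤ | ({t.1, t.2.1, t.2.2} : Finset ℤ).gcd id = 1 ∧
        A * t.1 ^ L + B * t.2.1 ^ 2 = C * t.2.2 ^ 3}.Finite) (S : Finset ℕ) :
    ∃ N₀ : ℕ, ∀ (W : WeierstrassCurve ℚ) [W.IsElliptic],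
      (∀ p : ℕ, p.Prime → p ∉ S → ¬ p ^ 2 ∣ W.conductorNorm ℤ) → N₀ ≤ W.conductorNorm ℤ →
      ∀ n k : ℕ, n.primeFactors ⊆ S → W.minimalDiscriminantNorm ℤ ≠ n * k ^ L := by
  classical
  have hL0 : L ≠ 0 := by omega
  -- `T`: the primes of `S` together with `2` and `3`
  set T : Finset ℕ := S.filter Nat.Prime ∪ {2, 3} with hT
  have hTprime : ∀ ℓ ∈ T, ℓ.Prime := by
    intro ℓ hℓ
    simp only [hT, Finset.mem_union, Finset.mem_filter, Finset.mem_insert,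
      Finset.mem_singleton] at hℓ
    rcases hℓ with ⟨-, h⟩ | rfl | rfl
    · exact h
    · exact Nat.prime_two
    · exact Nat.prime_three
  have hST : ∀ p : ℕ, p.Prime → p ∈ S → p ∈ T := fun p hp hpS =>
    Finset.mem_union_left _ (Finset.mem_filter.mpr ⟨hpS, hp⟩)
  have h2T : 2 ∈ T := Finset.mem_union_right _ (by simp)
  have h3T : 3 ∈ T := Finset.mem_union_right _ (by simp)
  obtain ⟨B₀, B₁, hB⟩ := PastenLemma610.exists_bounds_of_finite_properSolutions hL hFin hTprime
  -- the finite set of possible bad primes, and the conductor bound `N₀ = ∏_{p ∈ F} p⁸ + 1`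
  set F : Finset ℕ := T ∪ (Finset.range (B₀ + 1)).filter Nat.Prime with hF
  refine ⟨∏ p ∈ F, p ^ 8 + 1, fun W _ hS hN₀ n k hn hΔ => ?_⟩
  -- a global minimal equation `W₀` over `ℤ`
  obtain ⟨C, W₀, hCW, hmin⟩ := exists_baseChange_int_forall_isMinimalAt W
  have hΔ0 : W₀.Δ ≠ 0 := by
    intro h0
    have h1 : (C • W).Δ = 0 := by simp [hCW, baseChange, map_Δ, h0]
    exact (C • W).isUnit_Δ.ne_zero h1
  have hN : W.conductorNorm ℤ = (W₀.baseChange ℚ).conductorNorm ℤ := by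
    rw [← hCW, conductorNorm_smul_rat]
  have hD : W.minimalDiscriminantNorm ℤ = W₀.Δ.natAbs := by
    rw [← minimalDiscriminantNorm_smul_rat W C, hCW,
      minimalDiscriminantNorm_eq_natAbs_holds W₀ hΔ0 hmin]
  haveI := isElliptic_baseChange_int W₀ hΔ0
  rw [hN] at hS hN₀
  rw [hD] at hΔ
  set N : ℕ := (W₀.baseChange ℚ).conductorNorm ℤ with hNdef
  have hNne : N ≠ 0 := (conductorNorm_pos_holds (W₀.baseChange ℚ)).ne'
  have hn0 : n ≠ 0 := by
    rintro rfl
    rw [zero_mul] at hΔ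
    exact hΔ0 (Int.natAbs_eq_zero.mp hΔ)
  have hn' : ∀ q : ℕ, q.Prime → q ∣ n → q ∈ S := fun q hq hqn =>
    hn (Nat.mem_primeFactors.mpr ⟨hq, hqn, hn0⟩)
  -- the Diophantine equation `A k^L + c₆² = c₄³` and the Darmon–Granville bound
  obtain ⟨hA, hx, hAT, hcop, heq⟩ := PastenLemma610.dioph_setup hST h2T h3T hL0 W₀ hΔ0 hmin hS hn' hΔ
  have hbd := (hB _ _ _ _ hA hx hAT hcop heq).1
  -- every prime of `N` lies in `F`
  have hrad : N.primeFactors ⊆ F := by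
    intro p hpN
    have hp := Nat.prime_of_mem_primeFactors hpN
    have hpdN := Nat.dvd_of_mem_primeFactors hpN
    by_cases hpT : p ∈ T
    · exact Finset.mem_union_left _ hpT
    refine Finset.mem_union_right _ (Finset.mem_filter.mpr
      ⟨Finset.mem_range.mpr (Nat.lt_succ_of_le ?_), hp⟩)
    have hpΔ : p ∣ W₀.Δ.natAbs := by
      have h1 : p ∣ radical N := (dvd_radical_iff_of_irreducible hp hNne).mpr hpdN
      rw [hNdef, radical_conductorNorm_eq_holds (W₀.baseChange ℚ),
        minimalDiscriminantNorm_eq_natAbs_holds W₀ hΔ0 hmin] at h1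
      exact h1.trans radical_dvd_self
    rw [hΔ] at hpΔ
    rcases (Nat.Prime.dvd_mul hp).mp hpΔ with h | h
    · exact absurd (hST p hp (hn' p hp h)) hpT
    · exact hbd p hp hpT (by exact_mod_cast hp.dvd_of_dvd_pow h)
  -- `f_p ≤ 8`, so `N ≤ ∏_{p ∈ F} p⁸ < N₀ ≤ N`: contradiction
  have hfacN : ∏ p ∈ N.primeFactors, p ^ N.factorization p = N :=
    (PastenLemma610.nat_eq_prod_pow_factorization hNne subset_rfl).symm
  have hexp : ∀ p ∈ N.primeFactors, N.factorization p ≤ 8 := by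
    intro p hpN
    have hp := Nat.prime_of_mem_primeFactors hpN
    set v : HeightOneSpectrum ℤ := (Rat.HeightOneSpectrum.primesEquiv (R := ℤ)).symm ⟨p, hp⟩
      with hv
    have hgen : Rat.HeightOneSpectrum.natGenerator v = p := natGenerator_primesEquiv_symm p hp
    have hfac := factorization_conductorNorm_holds (W₀.baseChange ℚ) v
    rw [hgen] at hfac
    rw [hNdef, hfac]
    exact conductorExponent_le_eight_holds (W₀.baseChange ℚ) v
  have hle : N ≤ ∏ p ∈ F, p ^ 8 := by
    refine Nat.le_of_dvd (Finset.prod_pos fun p hp => pow_pos ?_ 8) ?_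
    · simp only [hF, Finset.mem_union, Finset.mem_filter] at hp
      rcases hp with hp | ⟨-, hp⟩
      · exact (hTprime p hp).pos
      · exact hp.pos
    calc N = ∏ p ∈ N.primeFactors, p ^ N.factorization p := hfacN.symm
      _ ∣ ∏ p ∈ N.primeFactors, p ^ 8 :=
          Finset.prod_dvd_prod_of_dvd _ _ fun p hp => pow_dvd_pow p (hexp p hp)
      _ ∣ ∏ p ∈ F, p ^ 8 := Finset.prod_dvd_prod_of_subset _ _ _ hrad
  omega

/-- **Pasten's Lemma 6.10 from Darmon–Granville's Theorem 2** [PastenShimura2024, §6.5,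
Lemma 6.10, p. 22]: for `L ≥ 7` and a finite set `S` there is `N₀(L, S)` such that no elliptic
curve `E/ℚ` semi-stable away from `S` (`p² ∤ N_E` for primes `p ∉ S`) with `N_E ≥ N₀` has
`|Δ_E| = n k^L` with all prime factors of `n` in `S` — assuming Darmon–Granville's Theorem 2 for
proper solutions with general coefficients (`darmonGranville1995_thm_2`, the tree's rendering of
[DarmonGranville1995, Thm 2]; Pasten's Lemma 6.9 is that theorem "replacing `V_{ABC}` by
`V_{ABC} ∪ S`"). The signature `(L, 2, 3)` is hyperbolic ("Since `1/2 + 1/3 + 1/L < 1`", p. 22),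
so Theorem 2 supplies the hypothesis of `PastenLemma610.conductor_bounded_of_finite_properSolutions`.
[cite: PastenShimura2024, Lemma 6.10 (§6.5, p. 22)] -/
theorem PastenShimura2024_lemma_6_10_of_darmonGranville1995_thm_2
    (hDG : Literature.NumberTheory.DiophantineGeometry.darmonGranville1995_thm_2) :
    PastenShimura2024_lemma_6_10 := by
  intro L hL S
  have hhyp : 2 * 3 + 3 * L + L * 2 < L * 2 * 3 := by nlinarith
  exact PastenLemma610.conductor_bounded_of_finite_properSolutions (by omega)
    (fun A B C hA hB hC => hDG A B C hA hB hC hhyp) S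

open IsDedekindDomain WeierstrassCurve in
/-- **Lemma 6.10 in the form its printed proof ends with, at ONE exponent `L`, from the finiteness
of the proper solutions of the equations `A x^L + B y² = C z³`** (hypothesis `hFin`; `L ≥ 3`)
[PastenShimura2024, §6.5, Lemma 6.10, p. 22: "Thus, for fixed `S` and `L`, there are only finitely
many elliptic curves `E` over `ℚ` with `Δ_E = n·k^L` for some integers `n, k` with `n` an `S`-unit"
— for the curves semi-stable away from `S` of the statement], as finiteness of the set of the
minimal discriminants `|Δ_E|` of such curves. Proof: with the data of `dioph_setup` for a global
minimal equation `W₀/ℤ`, `exists_bounds_of_finite_properSolutions` gives `c₆² ≤ G B₁` and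
`|c₄|³ ≤ G B₁` with `G = gcd(A k^L, c₆², c₄³) ≤ ∏_{p ∈ T} p²¹` by minimality
(`gcd_le_of_isMinimalAt`), and `1728 |Δ_E| = |c₄³ − c₆²|` — "a finite list of possible quantities
`c₄` and `c₆`" up to the bounded `T`-unit `G`.
[cite: PastenShimura2024, Lemma 6.10 (§6.5, p. 22)] -/
theorem PastenLemma610.finite_minimalDiscriminantNorm_of_finite_properSolutions {L : ℕ}
    (hL : 3 ≤ L)
    (hFin : ∀ A B C : ℤ, A ≠ 0 → B ≠ 0 → C ≠ 0 →
      {t : ℤ × ℤ × ℤ | ({t.1, t.2.1, t.2.2} : Finset ℤ).gcd id = 1 ∧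
        A * t.1 ^ L + B * t.2.1 ^ 2 = C * t.2.2 ^ 3}.Finite) (S : Finset ℕ) :
    {Δ : ℕ | ∃ (W : WeierstrassCurve ℚ) (_ : W.IsElliptic),
        (∀ q : ℕ, q.Prime → q ∉ S → ¬ q ^ 2 ∣ W.conductorNorm ℤ) ∧
        W.minimalDiscriminantNorm ℤ = Δ ∧
        ∃ n k : ℕ, (∀ q : ℕ, q.Prime → q ∣ n → q ∈ S) ∧ Δ = n * k ^ L}.Finite := by
  classical
  have hL0 : L ≠ 0 := by omega
  -- `T`: the primes of `S` together with `2` and `3`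
  set T : Finset ℕ := S.filter Nat.Prime ∪ {2, 3} with hT
  have hTprime : ∀ ℓ ∈ T, ℓ.Prime := by
    intro ℓ hℓ
    simp only [hT, Finset.mem_union, Finset.mem_filter, Finset.mem_insert,
      Finset.mem_singleton] at hℓ
    rcases hℓ with ⟨-, h⟩ | rfl | rfl
    · exact h
    · exact Nat.prime_two
    · exact Nat.prime_three
  have hST : ∀ p : ℕ, p.Prime → p ∈ S → p ∈ T := fun p hp hpS =>
    Finset.mem_union_left _ (Finset.mem_filter.mpr ⟨hpS, hp⟩)
  have h2T : 2 ∈ T := Finset.mem_union_right _ (by simp)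
  have h3T : 3 ∈ T := Finset.mem_union_right _ (by simp)
  obtain ⟨B₀, B₁, hB⟩ := PastenLemma610.exists_bounds_of_finite_properSolutions hL hFin hTprime
  -- the bound `|Δ_E| ≤ 2 · (∏_{p ∈ T} p²¹) · B₁`
  refine (Set.finite_Iic (2 * ((∏ p ∈ T, p ^ 21) * B₁))).subset ?_
  rintro Δ ⟨W, _, hS, hΔW, n, k, hn, hΔ⟩
  rw [Set.mem_Iic]
  -- a global minimal equation `W₀` over `ℤ`
  obtain ⟨C, W₀, hCW, hmin⟩ := exists_baseChange_int_forall_isMinimalAt W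
  have hΔ0 : W₀.Δ ≠ 0 := by
    intro h0
    have h1 : (C • W).Δ = 0 := by simp [hCW, baseChange, map_Δ, h0]
    exact (C • W).isUnit_Δ.ne_zero h1
  have hN : W.conductorNorm ℤ = (W₀.baseChange ℚ).conductorNorm ℤ := by
    rw [← hCW, conductorNorm_smul_rat]
  have hD : W.minimalDiscriminantNorm ℤ = W₀.Δ.natAbs := by
    rw [← minimalDiscriminantNorm_smul_rat W C, hCW,
      minimalDiscriminantNorm_eq_natAbs_holds W₀ hΔ0 hmin]
  rw [hN] at hS
  rw [hD] at hΔW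
  -- hΔW : W₀.Δ.natAbs = Δ
  obtain ⟨hA, hx, hAT, hcop, heq⟩ :=
    PastenLemma610.dioph_setup hST h2T h3T hL0 W₀ hΔ0 hmin hS hn (hΔW.trans hΔ)
  obtain ⟨-, hy2, hz3⟩ := hB _ _ _ _ hA hx hAT hcop heq
  have hG := PastenLemma610.gcd_le_of_isMinimalAt (L := L) hTprime W₀ hΔ0 hmin hA hx hAT hcop
  set G : ℕ := Int.gcd (Int.gcd (1728 * W₀.Δ.sign * n * (k : ℤ) ^ L) (W₀.c₆ ^ 2)) (W₀.c₄ ^ 3)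
    with hGdef
  have hc6 : (W₀.c₆ ^ 2).natAbs ≤ (∏ p ∈ T, p ^ 21) * B₁ := hy2.trans (Nat.mul_le_mul_right _ hG)
  have hc4 : (W₀.c₄ ^ 3).natAbs ≤ (∏ p ∈ T, p ^ 21) * B₁ := hz3.trans (Nat.mul_le_mul_right _ hG)
  -- `1728 Δ = c₄³ − c₆²`
  have hrel : (1728 * W₀.Δ).natAbs ≤ (W₀.c₄ ^ 3).natAbs + (W₀.c₆ ^ 2).natAbs := by
    rw [W₀.c_relation]
    exact Int.natAbs_sub_le _ _
  rw [Int.natAbs_mul] at hrel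
  have h1728 : (1728 : ℤ).natAbs = 1728 := rfl
  rw [h1728, hΔW] at hrel
  omega

/-- **Lemma 6.10 in the form its printed proof ends with, from Darmon–Granville's Theorem 2**
[PastenShimura2024, §6.5, Lemma 6.10, p. 22: "Thus, for fixed `S` and `L`, there are only
finitely many elliptic curves `E` over `ℚ` with `Δ_E = n·k^L` for some integers `n, k` with `n`
an `S`-unit" — for the curves semi-stable away from `S` of the statement], recorded, verbatim
as the hypothesis `h610` of `Literature.NumberTheory.Automorphic.PastenShimura2024_thm_6_17'`,
as finiteness of the set of the minimal discriminants `|Δ_E|` of such curves; the signature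
`(L, 2, 3)` being hyperbolic for `L ≥ 7`, Theorem 2 supplies the hypothesis of
`PastenLemma610.finite_minimalDiscriminantNorm_of_finite_properSolutions`.
[cite: PastenShimura2024, Lemma 6.10 (§6.5, p. 22)] -/
theorem finite_minimalDiscriminantNorm_of_darmonGranville1995_thm_2
    (hDG : Literature.NumberTheory.DiophantineGeometry.darmonGranville1995_thm_2) (S : Finset ℕ) :
    ∀ L : ℕ, 7 ≤ L → {Δ : ℕ | ∃ (W : WeierstrassCurve ℚ) (_ : W.IsElliptic),
        (∀ q : ℕ, q.Prime → q ∉ S → ¬ q ^ 2 ∣ W.conductorNorm ℤ) ∧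
        W.minimalDiscriminantNorm ℤ = Δ ∧
        ∃ n k : ℕ, (∀ q : ℕ, q.Prime → q ∣ n → q ∈ S) ∧ Δ = n * k ^ L}.Finite := by
  intro L hL
  have hhyp : 2 * 3 + 3 * L + L * 2 < L * 2 * 3 := by nlinarith
  exact PastenLemma610.finite_minimalDiscriminantNorm_of_finite_properSolutions (by omega)
    (fun A B C hA hB hC => hDG A B C hA hB hC hhyp) S

end Literature.NumberTheory.EllipticCurves
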